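import Summits.ResolutionOfSingularities.ResolutionOfSingularities.Theorems.FrobeniusLadderFInjectiveMacaulayficationOmegaOneS2KNewtonKFanTablesB
import Summits.ResolutionOfSingularities.ResolutionOfSingularities.Theorems.FrobeniusLadderFInjectiveMacaulayficationOmegaOneS2KNewtonKNewtonTables
import Summits.ResolutionOfSingularities.ResolutionOfSingularities.Theorems.FrobeniusLadderFInjectiveMacaulayficationFanCheckChunks
import HarnessLib

/-!
# HEAVY KERNEL CHECKS (fan side) of the BED Ω₁ refined class model X̃₂ class-route certificate: shapes, (hgen), unimodularity, vertex bridge, pure powers, (hAJ), the vertex property (hge)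
# RAY-CHUNK BY RAY-CHUNK, the local-matrix bridge `hVq` and the NEWTON MINIMISER check — each ONE `decide +kernel` on the tables of `OmegaOneS2KNewtonKFanTables` / `…FanTablesB` / `…NewtonTables`
# (crux `FInjectiveMacaulayfication` stmt-ResolutionOfSingularities-15315, chain w45a; Omega1 F6 W1, res-L1-w45a-plan-1 R23.23 (1) F6; seat res-L1-w45a-stub-3 g12)

Support file for crux stmt-ResolutionOfSingularities-15315 (`FrobeniusLadder.FInjectiveMacaulayfication`), chain w45a.
[OURS · L1 W4.5a] — NOT a statement of any manuscript; AI-written, weaker than expert review.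

The Boolean checks of res-L1-w45a-stub-4's `FanCheckKit` (+ res-L1-w45a-stub-2's `FanCheckMulti` / `FanCheckChunks`) on the BED Ω₁ refined class model X̃₂ class-route data (`f_B9 = z² + x⁹ + y⁹ + u⁹ + t⁹`, EVERY characteristic p ∤ 18 (p-uniform),
res-L1-w45a-stub-3's `Σ_f ∧ Σ(𝔪)` fan, 1223 charts, centre `𝔪·K` with `|K| = 6032`, 6032 generators; kit job j329694-konly, certificate sha16 abe6ee2c854b2a20): `checkShapes` (no exceptional vectors, `r = 0`),
`CL.length = 1223`, `checkHgen`, `checkDetUnit`, `FanCheckMulti.checkMVBridge`, `checkHprim`, `checkHAJ`, the length check of `KL2`, the vertex property `checkHge` as 24 ray-chunk checks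
`checkHgeFrom AL2 CL (6k) RAYS_k` glued by `FanCheckChunks.checkHgeFrom_append_true`, the bridge `Vq c = chartV 5 RAYS CL 1223 c`, and the NEWTON MINIMISER check
(`U0 c ∈ SUPPv` minimises every row functional of `Vq c` over `SUPPv` — the fan refines `Σ_f`). The cover records are checked in `OmegaOneS2KNewtonKCoverChecks`; the binders are `OmegaOneS2KNewtonKFan`.
No definitions, no named facts. [folklore; cite: CoxLittleSchenck2011, §2.3]
-/

-- single-problem summit: the doubled namespace component is forced
set_option linter.dupNamespace false

namespace Summit.ResolutionOfSingularities.ResolutionOfSingularities.Theorems.FInjectiveMacaulayfication.OmegaOneS2KNewtonKFan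

open Summit.ResolutionOfSingularities.ResolutionOfSingularities.Theorems.FInjectiveMacaulayfication
open FanCheckKit FanCheckSound

/-! ## Light checks (ONE `decide`; bundled with `CL.length = 1223`, which keeps every statement distinct from the sibling fan modules) -/

/-- (tlen, shapes, lengths of `K`'s table): light fan-side checks I. -/
theorem fan_checks_a : CL.length = 1223 ∧ checkShapes 5 0 AL2 RAYS CL = true ∧ (KL2.all fun ch => allLen 5 ch) = true := by
  decide +kernel

/-- (tlen, hgen, hV, vertex bridge): light fan-side checks II. -/
theorem fan_checks_b : CL.length = 1223 ∧ checkHgen 5 AL2 RAYS CL = true ∧ checkDetUnit 5 RAYS CL VinvTL = true ∧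
    FanCheckMulti.checkMVBridge 5 AL2 MV2 50 1223 CL = true := by
  decide +kernel

/-- (tlen, hprim, hAJ): light fan-side checks III. -/
theorem fan_checks_c : CL.length = 1223 ∧ checkHprim 5 AL2 PJ = true ∧ checkHAJ AL2 = true := by
  decide +kernel

/-- 1223 charts. -/
theorem tlen : CL.length = 1223 := fan_checks_a.1

/-- (shapes) lengths and index bounds of all tables. -/
theorem shapes : checkShapes 5 0 AL2 RAYS CL = true ∧ CL.length = 1223 := ⟨fan_checks_a.2.1, tlen⟩

/-- (hgen) `V c · a c i = V c · m c + e_i`. -/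
theorem check_hgen : checkHgen 5 AL2 RAYS CL = true ∧ CL.length = 1223 := ⟨fan_checks_b.2.1, tlen⟩

/-- (hV) `V c · W c = 1` over `ℤ`. -/
theorem check_det : checkDetUnit 5 RAYS CL VinvTL = true ∧ CL.length = 1223 := ⟨fan_checks_b.2.2.1, tlen⟩

/-- The vertex table `MV2` agrees with the chart records. -/
theorem check_mvbridge : FanCheckMulti.checkMVBridge 5 AL2 MV2 50 1223 CL = true := fan_checks_b.2.2.2

/-- (hprim) pure powers of all five variables among the generators. -/
theorem check_hprim : checkHprim 5 AL2 PJ = true ∧ CL.length = 1223 := ⟨fan_checks_c.2.1, tlen⟩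

/-- (hAJ) no generator is `0`. -/
theorem check_hAJ : checkHAJ AL2 = true ∧ CL.length = 1223 := ⟨fan_checks_c.2.2, tlen⟩

/-- Every chunk of `K`'s table consists of vectors of length 5. -/
theorem check_klen : (KL2.all fun ch => allLen 5 ch) = true ∧ CL.length = 1223 := ⟨fan_checks_a.2.2, tlen⟩

/-- 139 rays in 24 chunks of 6. -/
theorem rlens : RAYS_0.length = 6 ∧ RAYS_1.length = 6 ∧ RAYS_2.length = 6 ∧ RAYS_3.length = 6 ∧ RAYS_4.length = 6 ∧ RAYS_5.length = 6 ∧ RAYS_6.length = 6 ∧ RAYS_7.length = 6 ∧ RAYS_8.length = 6 ∧ RAYS_9.length = 6 ∧ RAYS_10.length = 6 ∧ RAYS_11.length = 6 ∧ RAYS_12.length = 6 ∧ RAYS_13.length = 6 ∧ RAYS_14.length = 6 ∧ RAYS_15.length = 6 ∧ RAYS_16.length = 6 ∧ RAYS_17.length = 6 ∧ RAYS_18.length = 6 ∧ RAYS_19.length = 6 ∧ RAYS_20.length = 6 ∧ RAYS_21.length = 6 ∧ RAYS_22.length = 6 ∧ RAYS_23.length = 1 := by decide +kernel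

/-! ## The Newton side: local matrices and minimisers -/

/-- The local matrix table agrees with `chartV 5 RAYS CL 1223`. -/
theorem hVq : ∀ c : Fin 1223, Vq c = chartV 5 RAYS CL 1223 c := by decide +kernel

/-- Every Newton minimiser is a support vector of `f_B9`. -/
theorem hU0_mem : ∀ c : Fin 1223, U0 c ∈ SUPPv := by decide +kernel

/-- ★ THE NEWTON MINIMISER CHECK (the fan refines `Σ_f`): on every chart, `U0 c` minimises every row functional of `Vq c` over the support of `f_B9` (explicit dot products). -/
theorem hmin_raw : ∀ c : Fin 1223, ∀ i : Fin 5, ∀ u ∈ SUPPv,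
    Vq c i 0 * U0 c 0 + Vq c i 1 * U0 c 1 + Vq c i 2 * U0 c 2 + Vq c i 3 * U0 c 3 + Vq c i 4 * U0 c 4 ≤
      Vq c i 0 * u 0 + Vq c i 1 * u 1 + Vq c i 2 * u 2 + Vq c i 3 * u 3 + Vq c i 4 * u 4 := by
  decide +kernel

/-- The pure powers `x_j^(N_j)` in `K` (the last five generators), as a membership check on the flattened table — so `𝔪 ⊆ √K`. -/
theorem hKpow : (Pi.single 0 137172 : Fin 5 → ℕ) ∈ KL2.flatten.map (vecOf 5) ∧ (Pi.single 1 115093 : Fin 5 → ℕ) ∈ KL2.flatten.map (vecOf 5) ∧ (Pi.single 2 115093 : Fin 5 → ℕ) ∈ KL2.flatten.map (vecOf 5) ∧ (Pi.single 3 137172 : Fin 5 → ℕ) ∈ KL2.flatten.map (vecOf 5) ∧ (Pi.single 4 28770 : Fin 5 → ℕ) ∈ KL2.flatten.map (vecOf 5) ∧ CL.length = 1223 := by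
  refine ⟨?_, ?_, ?_, ?_, ?_, tlen⟩ <;> decide +kernel


end Summit.ResolutionOfSingularities.ResolutionOfSingularities.Theorems.FInjectiveMacaulayfication.OmegaOneS2KNewtonKFan
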